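import Literature.AlgebraicGeometry.AbelianSchemes.RigidifiedLineBundleComapHom
import Literature.AlgebraicGeometry.AbelianSchemes.AbelianSchemeDualTransport
import HarnessLib

/-!
# The dual homomorphism `ψ^∨ : B̂ → Â′` of a homomorphism `ψ : A′ → B` of abelian schemes (HECKE-LINK, export (e1) for (T3b))

Layer `Literature/AlgebraicGeometry/AbelianSchemes`, namespace `Literature.AlgebraicGeometry.AbelianSchemes.AbelianSchemeOver.DualPair`.
Cell `hodgecm-mathlib`, HECKE-LINK line card v1.2 §1 — the export B-p11 (g13)'s (T3b) engine `IsLambdaOfAtAlongIsogeny` and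
B-p04 (g17)'s (γ) composition read (shapes agreed on the bus 20:37:13Z / 20:40:29Z / 20:41:35Z).
[MumfordAV1970] §15 (p. 143) / [MilneAV2008] I §9 («the dual homomorphism `f^∨ : B^∨ → A^∨` is the morphism classifying
`(f × 1)^*𝒫_B`»): for abelian schemes `A′, B` over `S` with dual pairs `D′ = (Â′, 𝒫′)`, `DB = (B̂, 𝒫_B)` (★
`AbelianSchemeDualPair`) and a HOMOMORPHISM `ψ : A′ → B` over `S`, the pull-back `(ψ × 1_{B̂})^*𝒫_B` is a rigidified
fibrewise-`Pic⁰` family on `A′` parametrised by `B̂` (★ (u1) `RigidifiedLineBundle.comapHom`, p743509, applied to `𝒫_B` as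
the family ★ `DualPair.selfBundle DB`), hence CLASSIFIED (★ `DualPair.classify`) by a unique `S`-morphism
**`dualIsogeny ψ D′ DB = ψ^∨ : B̂ → Â′`** with **`(1 × ψ^∨)^*𝒫′ ≅ (ψ × 1)^*𝒫_B`** (`nonempty_pullbackP_dualIsogeny_iso`, the
export (e1)) and the uniqueness `eq_dualIsogeny`.  Definitions with bodies (`dualIsogeny`, `dualIsogenyOver`) + theorems;
no `Prop`-valued def, no instance, no sorry.  (That `ψ^∨` is a homomorphism, and `(χ ∘ ψ)^∨ = ψ^∨ ∘ χ^∨`, are follow-ups: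
rigidity ★ `isMonHom_of_one_comp_of_isReduced_base` over a reduced base, resp. `eq_dualIsogeny`.)  HC_CM is proved only
modulo the 7 printed citations until rung 0 closes; nothing here is about HC.

## References
* [MumfordAV1970] D. Mumford, *Abelian Varieties* (1970), §15 Thm. 1 (p. 143).
* [MilneAV2008] J. S. Milne, *Abelian Varieties* (2008), I §8 pp. 36–37, I §9 (p. 42).
-/

noncomputable section

universe u

open CategoryTheory CategoryTheory.Limits AlgebraicGeometry MonoidalCategory CartesianMonoidalCategory
open scoped MonObj

namespace Literature.AlgebraicGeometry.AbelianSchemes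

namespace AbelianSchemeOver

namespace DualPair

variable {S : Scheme.{u}} {A' B : AbelianSchemeOver S} (ψ : A'.X ⟶ B.X) [IsMonHom ψ]
  (D' : A'.DualPair) (DB : B.DualPair)

/-- **`(ψ × 1_{B̂})^*𝒫_B` as a rigidified fibrewise-`Pic⁰` family on `A′` parametrised by `B̂`** (★ `selfBundle`, ★ (u1)
`comapHom`). [cite: MilneAV2008, I §8 pp. 36–37] -/
def pullbackSelfBundle : A'.RigidifiedLineBundle DB.hat.X.hom :=
  (selfBundle DB).comapHom ψ

/-- Its module is `(ψ_{B̂})^*𝒫_B` (definitional). [cite: MilneAV2008, I §8 pp. 36–37] -/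
theorem pullbackSelfBundle_L :
    (pullbackSelfBundle ψ DB).L = (Scheme.Modules.pullback (baseChangeHom ψ DB.hat.X.hom).left).obj DB.P :=
  rfl

/-- `(ψ × 1)^*𝒫_B` lies fibrewise in `Pic⁰`. [cite: MilneAV2008, I §8 pp. 36–37] -/
theorem pullbackSelfBundle_fibrewisePicZero : (pullbackSelfBundle ψ DB).FibrewisePicZero :=
  (selfBundle_fibrewisePicZero DB).comapHom ψ

/-- **The DUAL HOMOMORPHISM `ψ^∨ : B̂ → Â′`** — the morphism classifying `(ψ × 1)^*𝒫_B` (★ `classify`).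
[cite: MumfordAV1970, §15 Thm. 1 (p. 143)] [cite: MilneAV2008, I §9 Thm. 9.1 (p. 42)] -/
def dualIsogeny : DB.hat.X.left ⟶ D'.hat.X.left :=
  D'.classify DB.hat.X.hom (pullbackSelfBundle ψ DB) (pullbackSelfBundle_fibrewisePicZero ψ DB)

/-- `ψ^∨` lies over `S`. [cite: MilneAV2008, I §8 pp. 36–37] -/
@[reassoc (attr := simp)]
theorem dualIsogeny_comp_hom : dualIsogeny ψ D' DB ≫ D'.hat.X.hom = DB.hat.X.hom :=
  D'.classify_comp_hom _ _ _

/-- `ψ^∨` as a morphism of `S`-schemes `B̂ → Â′` in `Over S`. [cite: MilneAV2008, I §8 pp. 36–37] -/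
def dualIsogenyOver : DB.hat.X ⟶ D'.hat.X :=
  Over.homMk (dualIsogeny ψ D' DB) (dualIsogeny_comp_hom ψ D' DB)

/-- The underlying morphism of `dualIsogenyOver`. [cite: MilneAV2008, I §8 pp. 36–37] -/
@[simp]
theorem dualIsogenyOver_left : (dualIsogenyOver ψ D' DB).left = dualIsogeny ψ D' DB := rfl

/-- **Export (e1): `(1 × ψ^∨)^*𝒫′ ≅ (ψ × 1)^*𝒫_B`** (the defining property of the classifying morphism).
[cite: MumfordAV1970, §15 Thm. 1 (p. 143)] [cite: MilneAV2008, I §8 pp. 36–37] -/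
theorem nonempty_pullbackP_dualIsogeny_iso :
    Nonempty (D'.pullbackP DB.hat.X.hom (dualIsogeny ψ D' DB) (dualIsogeny_comp_hom ψ D' DB) ≅
      (Scheme.Modules.pullback (baseChangeHom ψ DB.hat.X.hom).left).obj DB.P) :=
  D'.nonempty_pullbackP_classify_iso _ _ _

/-- **Uniqueness of `ψ^∨`**: any `S`-morphism `g : B̂ → Â′` with `(1 × g)^*𝒫′ ≅ (ψ × 1)^*𝒫_B` is `ψ^∨`.
[cite: MilneAV2008, I §8 pp. 36–37] -/
theorem eq_dualIsogeny (g : DB.hat.X.left ⟶ D'.hat.X.left) (hg : g ≫ D'.hat.X.hom = DB.hat.X.hom)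
    (h : Nonempty (D'.pullbackP DB.hat.X.hom g hg ≅
      (Scheme.Modules.pullback (baseChangeHom ψ DB.hat.X.hom).left).obj DB.P)) :
    g = dualIsogeny ψ D' DB :=
  D'.eq_classify _ _ _ g hg h

end DualPair

end AbelianSchemeOver

end Literature.AlgebraicGeometry.AbelianSchemes

end
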